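import Literature.MathematicalPhysics.QuantumLattice.EmeryThreeBandCuO4WindowFloor
import Literature.MathematicalPhysics.QuantumLattice.EmeryThreeBandClusterTrialCap
import Literature.MathematicalPhysics.QuantumLattice.HubbardOpenBoxGeneralPairCluster
import Literature.MathematicalPhysics.QuantumLattice.HubbardFermionInteractionLocalHamiltonian
import HarnessLib

/-!
# The reweighted three-band (Emery) cluster Hamiltonian in GENERAL-PAIR FORM: on every finite window `W` and for every weight `w`,
# `H^w_W[emeryInteraction θ] = −Σ_{p≠p',σ} τ(p,p') c†_{pσ}c_{p'σ} + Σ_p υ(p) n_{p↑}n_{p↓} + Σ_p ν(p)(n_{p↑}+n_{p↓})` with explicit `τ, υ, ν`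

Topic `Literature/MathematicalPhysics/QuantumLattice` (family `hubbard`; crew hubbard-fast S2 (iv) «three-band Emery boxes»). The cluster-floor doors for the
decorated `CuO₂` model (`le_emeryEnergyDensity_of_posSemidef_uniform/_reweight`, the Downfold seam `EmeryClusterFloorSeam` and its La₂CuO₄ order
`emeryBoxLa214v122_cuprate_energyFloor54_of_cuO4Certificates`) take a certificate on the abstract operator
`H^w_W[Ψ] := (⟨X ↦ w(X)·Ψ.Φ X⟩).localHamiltonian W`, while the kernel cluster device (hubbard-box-p2's `HubbardOpenBoxGeneralPairCluster(Oracle)`) certifies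
sector ground energies of the explicit general-pair operator `hubbardOpenBoxGP a b τ υ ν` on `Fin a ×ₗ Fin b`. This file is the MODEL SIDE of the dictionary:

* §1 `generalPairHamiltonian τ υ ν` on any ordered finite site type (the formula of `hubbardOpenBoxGP`, so `hubbardOpenBoxGP a b τ υ ν = generalPairHamiltonian τ υ ν`
  by `rfl`) and its RELABELLING LAW along a site bijection (`relabel_generalPairHamiltonian`).
* §2 generic bookkeeping: sums over the powerset supported on the pairs `{x, x+v}` of ONE vector / on singletons; the reweighted local Hamiltonians of a
  sublattice HOPPING atom (`localHamiltonian_reweight_sublatticeVectorHopping`) and of a sublattice ON-SITE atom (`…_sublatticeOnSite`) as sums over the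
  sites `p : PolySite W` with the explicit coefficients `hopCoef w q c v` / `siteCoef w q c`.
* §3 **`localHamiltonian_reweight_emeryInteraction_eq_generalPair`**: for EVERY window `W ⊆ ℤ²`, weight `w` and `θ ∈ ℝ¹⁴`,
  `H^w_W[emeryInteraction θ] = generalPairHamiltonian (emeryTau w θ) (emeryUps w θ) (emeryNu w θ)` with
  `emeryTau w θ p p' = Σ_{a<8} θ_a · w{p̄,p̄'} · ([p̄' = p̄ + v_a ∧ p̄ ∈ c_a] + [p̄ = p̄' + v_a ∧ p̄' ∈ c_a])` (bond classes `(c_a, v_a)` = (Cu,e₁), (O_x,e₁), (Cu,e₂), (O_y,e₂),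
  (O_x, ppVec k)), `emeryUps w θ p = w{p̄}·(θ₁₁[p̄ ∈ Cu] + θ₁₂[p̄ ∈ O_x] + θ₁₃[p̄ ∈ O_y])`, `emeryNu w θ p = w{p̄}·(θ₈[Cu] + θ₉[O_x] + θ₁₀[O_y])`.
  With the uniform `(2ℤ)²` weight and a site bijection `f : PolySite W ≃ Fin a ×ₗ Fin b` (sequel `EmeryThreeBandCuO4ClusterDictionary` for the plus `W₅`),
  `relabel (Orb.mapEquiv f) (H^w_W[emeryInteraction θ]) = hubbardOpenBoxGP a b (emeryTau∘f⁻¹) (emeryUps∘f⁻¹) (emeryNu∘f⁻¹)`.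

Everything is PROVED (0 sorry); definitions with bodies: `generalPairHamiltonian`, `emeryAtomCoset/Vec/Eps/U`, `hopInd`, `emeryAtomPairCoef/UCoef/ECoef`, `emeryTau`, `emeryUps`, `emeryNu`, `emeryAtomGP`.
HONEST SCOPE: an operator identity; no number.

## Tree / Mathlib search

REUSED: `hubbardOpenBoxGP` (`HubbardOpenBoxGeneralPairCluster`, hubbard-box-p2); `relabel`, `relabel_creation/annihilation`, `Orb.mapEquiv(_orb)`, `relabel_mapEquiv_numberOp`
(`FermionRelabelling`); `emeryInteraction`, `emeryAtoms` (`EmeryThreeBandClusterFloor`); `localHamiltonian_emeryInteraction`-pattern, `emeryAtoms_cases`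
(`EmeryThreeBandClusterTrialCap`); `sublatticeVectorHopping_apply_pair/_apply_eq_zero`, `sublatticeOnSite_apply_singleton/_apply_eq_zero`, `InCoset`
(`SublatticeSelectiveInteractions`); `vectorHoppingFermionInteraction_apply_pair`; `FermionInteraction.localHamiltonian_eq_sum`, `sum_attach_ite_eq`,
`sum_powerset_eq_of_hubbard_support`-pattern (`HubbardFermionInteractionLocalHamiltonian`); `fermionEmbed_incl_cAt`, `fermionEmbed_conjTranspose`, `fermionEmbed_numberOp`.
`rg 'generalPair|emeryTau'` (QuantumLattice, 2026-08-28): nothing.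

## References

* E. Pavarini et al., Phys. Rev. Lett. 87 (2001) 047003, eq. (1). [cite: PavariniEtAl2001, eq. (1)]
* R. Valentí, J. Stolze, P. J. Hirschfeld, Phys. Rev. B 43 (1991) 13743, §II (weighted cluster Hamiltonians). [cite: ValentiStolzeHirschfeld1991, §II]
* E. H. Lieb, Phys. Rev. Lett. 62 (1989) 1201, eq. (1) (general hopping matrices). [cite: LiebPRL1989, eq. (1)]
-/

noncomputable section

open scoped ComplexOrder BigOperators
open Finset

namespace Literature.MathematicalPhysics.QuantumLattice

open Matrix HubbardWave0 Literature.Probability.LatticeModels ThermodynamicLimit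

/-! ### §1. The general-pair cluster operator and its relabelling law -/

section GeneralPair

variable {Λ₀ Λ₁ : Type*} [LinearOrder Λ₀] [Fintype Λ₀] [LinearOrder Λ₁] [Fintype Λ₁]

/-- **The general-pair cluster operator** `−Σ_{x≠y,σ} τ(x,y) c†_{xσ}c_{yσ} + Σ_x υ(x) n_{x↑}n_{x↓} + Σ_x ν(x)(n_{x↑}+n_{x↓})` on any ordered finite site type
(the formula of `hubbardOpenBoxGP`). [cite: LiebPRL1989, eq. (1)] -/
def generalPairHamiltonian (τ : Λ₀ → Λ₀ → ℝ) (υ ν : Λ₀ → ℝ) : Matrix (Finset (Orb Λ₀)) (Finset (Orb Λ₀)) ℂ :=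
  -(∑ x : Λ₀, ∑ y : Λ₀, ∑ σ : Fin 2, if x ≠ y then ((τ x y : ℝ) : ℂ) • (creation (orb x σ) * annihilation (orb y σ)) else 0) +
    ∑ x : Λ₀, ((υ x : ℝ) : ℂ) • (numberOp x 0 * numberOp x 1) +
    ∑ x : Λ₀, ((ν x : ℝ) : ℂ) • (numberOp x 0 + numberOp x 1)

/-- `hubbardOpenBoxGP a b τ υ ν` IS `generalPairHamiltonian τ υ ν` on `Fin a ×ₗ Fin b`. [cite: LiebPRL1989, eq. (1)] -/
theorem hubbardOpenBoxGP_eq_generalPairHamiltonian (a b : ℕ) (τ : Fin a ×ₗ Fin b → Fin a ×ₗ Fin b → ℝ) (υ ν : Fin a ×ₗ Fin b → ℝ) :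
    ClusterLowerBound.hubbardOpenBoxGP a b τ υ ν = generalPairHamiltonian τ υ ν := rfl

/-- **RELABELLING LAW**: along a site bijection `f`, `Γ_f (generalPairHamiltonian τ υ ν) = generalPairHamiltonian (τ ∘ f⁻¹) (υ ∘ f⁻¹) (ν ∘ f⁻¹)`.
[cite: LiebPRL1989, eq. (1)] -/
theorem relabel_generalPairHamiltonian (f : Λ₀ ≃ Λ₁) (τ : Λ₀ → Λ₀ → ℝ) (υ ν : Λ₀ → ℝ) :
    relabel (Orb.mapEquiv f) (generalPairHamiltonian τ υ ν) =
      generalPairHamiltonian (fun x y => τ (f.symm x) (f.symm y)) (fun x => υ (f.symm x)) (fun x => ν (f.symm x)) := by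
  unfold generalPairHamiltonian
  simp only [map_add, map_neg, map_sum, map_smul, map_mul, relabel_mapEquiv_numberOp]
  congr 1
  · congr 1
    · congr 1
      refine Fintype.sum_equiv f _ _ fun x => ?_
      refine Fintype.sum_equiv f _ _ fun y => ?_
      refine Finset.sum_congr rfl fun σ _ => ?_
      by_cases hxy : x ≠ y
      · have hfxy : f x ≠ f y := fun h => hxy (f.injective h)
        rw [if_pos hxy, if_pos hfxy, map_smul, map_mul, relabel_creation, relabel_annihilation, Orb.mapEquiv_orb, Orb.mapEquiv_orb,
          Equiv.symm_apply_apply, Equiv.symm_apply_apply]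
      · have hfxy : ¬ f x ≠ f y := fun h => hxy fun h' => h (congrArg f h')
        rw [if_neg hxy, if_neg hfxy, map_zero]
    · refine Fintype.sum_equiv f _ _ fun x => ?_
      rw [Equiv.symm_apply_apply]
  · refine Fintype.sum_equiv f _ _ fun x => ?_
    rw [Equiv.symm_apply_apply]

/-- Pulling a finite combination of scalars out of a triple sum of guarded terms. [folklore] -/
private theorem sum_smul_tripleSum_ite {ι : Type*} [Fintype ι] (c : ι → ℂ) (r : ι → Λ₀ → Λ₀ → ℂ)
    (T : Λ₀ → Λ₀ → Fin 2 → Matrix (Finset (Orb Λ₀)) (Finset (Orb Λ₀)) ℂ) :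
    (∑ x : Λ₀, ∑ y : Λ₀, ∑ σ : Fin 2, if x ≠ y then (∑ a, c a * r a x y) • T x y σ else 0) =
      ∑ a, c a • ∑ x : Λ₀, ∑ y : Λ₀, ∑ σ : Fin 2, if x ≠ y then r a x y • T x y σ else 0 := by
  symm
  calc ∑ a, c a • ∑ x : Λ₀, ∑ y : Λ₀, ∑ σ : Fin 2, (if x ≠ y then r a x y • T x y σ else 0)
      = ∑ a, ∑ x : Λ₀, ∑ y : Λ₀, ∑ σ : Fin 2, (if x ≠ y then (c a * r a x y) • T x y σ else 0) := by
        refine Finset.sum_congr rfl fun a _ => ?_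
        simp only [Finset.smul_sum, smul_ite, smul_zero, smul_smul]
    _ = ∑ x : Λ₀, ∑ a, ∑ y : Λ₀, ∑ σ : Fin 2, (if x ≠ y then (c a * r a x y) • T x y σ else 0) := Finset.sum_comm
    _ = ∑ x : Λ₀, ∑ y : Λ₀, ∑ a, ∑ σ : Fin 2, (if x ≠ y then (c a * r a x y) • T x y σ else 0) :=
        Finset.sum_congr rfl fun _ _ => Finset.sum_comm
    _ = ∑ x : Λ₀, ∑ y : Λ₀, ∑ σ : Fin 2, ∑ a, (if x ≠ y then (c a * r a x y) • T x y σ else 0) :=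
        Finset.sum_congr rfl fun _ _ => Finset.sum_congr rfl fun _ _ => Finset.sum_comm
    _ = _ := by
        refine Finset.sum_congr rfl fun x _ => Finset.sum_congr rfl fun y _ => Finset.sum_congr rfl fun σ _ => ?_
        by_cases hxy : x ≠ y
        · simp only [if_pos hxy, Finset.sum_smul]
        · simp only [if_neg hxy, Finset.sum_const_zero]

omit [LinearOrder Λ₀] in
/-- Pulling a finite combination of scalars out of a single sum. [folklore] -/
private theorem sum_smul_sum_smul {ι : Type*} [Fintype ι] (c : ι → ℂ) (r : ι → Λ₀ → ℂ) (T : Λ₀ → Matrix (Finset (Orb Λ₀)) (Finset (Orb Λ₀)) ℂ) :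
    (∑ x : Λ₀, (∑ a, c a * r a x) • T x) = ∑ a, c a • ∑ x : Λ₀, r a x • T x := by
  symm
  calc ∑ a, c a • ∑ x : Λ₀, r a x • T x = ∑ a, ∑ x : Λ₀, (c a * r a x) • T x := by
        refine Finset.sum_congr rfl fun a _ => ?_
        simp only [Finset.smul_sum, smul_smul]
    _ = ∑ x : Λ₀, ∑ a, (c a * r a x) • T x := Finset.sum_comm
    _ = _ := Finset.sum_congr rfl fun x _ => by rw [Finset.sum_smul]

/-- **Linearity of the general-pair operator in its coefficient tables**: a real combination of tables gives the same combination of operators.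
[cite: LiebPRL1989, eq. (1)] -/
theorem generalPairHamiltonian_linear {ι : Type*} [Fintype ι] (c : ι → ℝ) (τ : ι → Λ₀ → Λ₀ → ℝ) (υ ν : ι → Λ₀ → ℝ) :
    generalPairHamiltonian (fun x y => ∑ a, c a * τ a x y) (fun x => ∑ a, c a * υ a x) (fun x => ∑ a, c a * ν a x) =
      ∑ a, ((c a : ℝ) : ℂ) • generalPairHamiltonian (τ a) (υ a) (ν a) := by
  unfold generalPairHamiltonian
  simp only [Complex.ofReal_sum, Complex.ofReal_mul]
  rw [sum_smul_tripleSum_ite, sum_smul_sum_smul (fun a => ((c a : ℝ) : ℂ)) (fun a x => ((υ a x : ℝ) : ℂ)),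
    sum_smul_sum_smul (fun a => ((c a : ℝ) : ℂ)) (fun a x => ((ν a x : ℝ) : ℂ)), ← Finset.sum_neg_distrib, ← Finset.sum_add_distrib,
    ← Finset.sum_add_distrib]
  refine Finset.sum_congr rfl fun a _ => ?_
  rw [smul_add, smul_add, smul_neg]

end GeneralPair

/-! ### §2. Generic bookkeeping: sums supported on the pairs of one vector / on singletons; reweighted atoms -/

section Atoms

variable {d : ℕ}

/-- **Sums over the powerset supported on the pairs `{x, x+v}` of ONE nonzero vector**:
`Σ_{X ⊆ Λ} F X = Σ_{x ∈ Λ, x+v ∈ Λ} F {x, x+v}`. [cite: ArakiMoriya2003, §5.1 (local Hamiltonian H(I))] -/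
theorem sum_powerset_eq_of_pair_support {M : Type*} [AddCommMonoid M] (Λ : Finset (Site d)) {v : Site d} (hv : v ≠ 0)
    (F : Finset (Site d) → M) (hF : ∀ X : Finset (Site d), (∀ x : Site d, X ≠ {x, x + v}) → F X = 0) :
    ∑ X ∈ Λ.powerset, F X = ∑ x ∈ Λ with x + v ∈ Λ, F {x, x + v} := by
  classical
  set P : Finset (Site d) := Λ.filter fun x => x + v ∈ Λ with hP
  set S' : Finset (Finset (Site d)) := P.image fun x => ({x, x + v} : Finset (Site d)) with hS'
  have hS'sub : S' ⊆ Λ.powerset := by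
    intro X hX
    rw [hS', mem_image] at hX
    obtain ⟨x, hx, rfl⟩ := hX
    rw [hP, mem_filter] at hx
    exact mem_powerset.2 (insert_subset hx.1 (singleton_subset_iff.2 hx.2))
  have hzero : ∀ X ∈ Λ.powerset, X ∉ S' → F X = 0 := by
    intro X hX hXS
    rw [mem_powerset] at hX
    refine hF X fun x hx => hXS ?_
    rw [hS', mem_image]
    refine ⟨x, ?_, hx.symm⟩
    rw [hP, mem_filter]
    exact ⟨hX (hx ▸ mem_insert_self _ _), hX (hx ▸ mem_insert_of_mem (mem_singleton_self _))⟩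
  rw [← Finset.sum_subset hS'sub hzero]
  have hinj : Set.InjOn (fun x : Site d => ({x, x + v} : Finset (Site d))) ↑P := by
    intro x _ y _ h
    dsimp only at h
    have hx : x ∈ ({y, y + v} : Finset (Site d)) := h ▸ mem_insert_self _ _
    rw [mem_insert, mem_singleton] at hx
    rcases hx with hxy | hxy
    · exact hxy
    · have hxv : x + v ∈ ({y, y + v} : Finset (Site d)) := h ▸ mem_insert_of_mem (mem_singleton_self _)
      rw [mem_insert, mem_singleton] at hxv
      rcases hxv with h' | h'
      · rw [hxy, add_assoc] at h'
        exact absurd (add_eq_left.1 h') (add_self_ne_zero_of_ne_zero hv)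
      · exact add_right_cancel h'
  rw [hS', Finset.sum_image hinj]

/-- **Sums over the powerset supported on singletons**: `Σ_{X ⊆ Λ} F X = Σ_{x ∈ Λ} F {x}`. [cite: ArakiMoriya2003, §5.1 (local Hamiltonian H(I))] -/
theorem sum_powerset_eq_of_singleton_support {M : Type*} [AddCommMonoid M] (Λ : Finset (Site d))
    (F : Finset (Site d) → M) (hF : ∀ X : Finset (Site d), (∀ x : Site d, X ≠ {x}) → F X = 0) :
    ∑ X ∈ Λ.powerset, F X = ∑ x ∈ Λ, F {x} := by
  classical
  set S' : Finset (Finset (Site d)) := Λ.image fun x => ({x} : Finset (Site d)) with hS'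
  have hS'sub : S' ⊆ Λ.powerset := by
    intro X hX
    rw [hS', mem_image] at hX
    obtain ⟨x, hx, rfl⟩ := hX
    exact mem_powerset.2 (singleton_subset_iff.2 hx)
  have hzero : ∀ X ∈ Λ.powerset, X ∉ S' → F X = 0 := by
    intro X hX hXS
    rw [mem_powerset] at hX
    refine hF X fun x hx => hXS ?_
    rw [hS', mem_image]
    exact ⟨x, hX (hx ▸ mem_singleton_self x), hx.symm⟩
  rw [← Finset.sum_subset hS'sub hzero]
  have hinj : Set.InjOn (fun x : Site d => ({x} : Finset (Site d))) ↑Λ := fun x _ y _ h => singleton_injective h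
  rw [hS', Finset.sum_image hinj]

/-- **The reweighted local Hamiltonian of a sublattice HOPPING atom**: a sum over the sites `x ∈ Λ` with `x + v ∈ Λ` and `x` in the coset of
`−t·w{x,x+v}·Σ_σ (c†_{xσ}c_{x+v,σ} + c†_{x+v,σ}c_{xσ})`. [cite: ValentiStolzeHirschfeld1991, §II] -/
theorem localHamiltonian_reweight_sublatticeVectorHopping (w : Finset (Site d) → ℝ) (q : Fin d → ℕ) (c : Site d) {v : Site d} (hv : v ≠ 0)
    (t : ℝ) (Λ : Finset (Site d)) :
    (⟨fun X => (w X : ℂ) • (sublatticeVectorHopping q c v t).Φ X⟩ : FermionInteraction d).localHamiltonian Λ =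
      ∑ x ∈ Λ.attach, if h : x.1 + v ∈ Λ ∧ InCoset q c x.1 then
        ((w {x.1, x.1 + v} : ℝ) : ℂ) • (-(t : ℂ) • ∑ σ : Fin 2,
          ((cAt x.1 x.2 σ)ᴴ * cAt (x.1 + v) h.1 σ + (cAt (x.1 + v) h.1 σ)ᴴ * cAt x.1 x.2 σ)) else 0 := by
  classical
  rw [FermionInteraction.localHamiltonian_eq_sum]
  rw [sum_powerset_eq_of_pair_support Λ hv _ (fun X hX => by
    dsimp only
    rw [sublatticeVectorHopping_apply_eq_zero q c v t hX, smul_zero]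
    split_ifs <;> simp)]
  rw [Finset.sum_filter, ← Finset.sum_attach Λ]
  refine Finset.sum_congr rfl fun x _ => ?_
  by_cases hxv : x.1 + v ∈ Λ
  · have hsub : ({x.1, x.1 + v} : Finset (Site d)) ⊆ Λ := insert_subset x.2 (singleton_subset_iff.2 hxv)
    rw [if_pos hxv]
    dsimp only
    rw [dif_pos hsub, sublatticeVectorHopping_apply_pair q c hv t x.1]
    by_cases hc : InCoset q c x.1
    · rw [if_pos hc, dif_pos ⟨hxv, hc⟩, vectorHoppingFermionInteraction_apply_pair hv, map_smul, map_smul, map_sum]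
      congr 2
      refine Finset.sum_congr rfl fun σ _ => ?_
      rw [map_add, map_mul, map_mul, fermionEmbed_conjTranspose, fermionEmbed_conjTranspose, fermionEmbed_incl_cAt, fermionEmbed_incl_cAt]
    · rw [if_neg hc, dif_neg (fun h => hc h.2), smul_zero, map_zero]
  · rw [if_neg hxv, dif_neg (fun h => hxv h.1)]

/-- **The reweighted local Hamiltonian of a sublattice ON-SITE atom**: a sum over the sites of `Λ` in the coset of
`w{x}·(ε(n_{x↑}+n_{x↓}) + U n_{x↑}n_{x↓})`. [cite: ValentiStolzeHirschfeld1991, §II] -/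
theorem localHamiltonian_reweight_sublatticeOnSite (w : Finset (Site d) → ℝ) (q : Fin d → ℕ) (c : Site d) (ε U : ℝ)
    (Λ : Finset (Site d)) :
    (⟨fun X => (w X : ℂ) • (sublatticeOnSite q c ε U).Φ X⟩ : FermionInteraction d).localHamiltonian Λ =
      ∑ x ∈ Λ.attach, if InCoset q c x.1 then
        ((w {x.1} : ℝ) : ℂ) • ((ε : ℂ) • (nAt x.1 x.2 0 + nAt x.1 x.2 1) + (U : ℂ) • (nAt x.1 x.2 0 * nAt x.1 x.2 1)) else 0 := by
  classical
  rw [FermionInteraction.localHamiltonian_eq_sum]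
  rw [sum_powerset_eq_of_singleton_support Λ _ (fun X hX => by
    dsimp only
    rw [sublatticeOnSite_apply_eq_zero q c ε U hX, smul_zero]
    split_ifs <;> simp)]
  rw [← Finset.sum_attach Λ]
  refine Finset.sum_congr rfl fun x _ => ?_
  have hsub : ({x.1} : Finset (Site d)) ⊆ Λ := singleton_subset_iff.2 x.2
  dsimp only
  rw [dif_pos hsub, sublatticeOnSite_apply_singleton]
  by_cases hc : InCoset q c x.1
  · have hn : ∀ σ, fermionEmbed (PolySite.incl hsub) (nAt x.1 (mem_singleton_self _) σ) = nAt x.1 x.2 σ := fun σ => by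
      rw [nAt, nAt, fermionEmbed_numberOp, PolySite.incl_pt]
    rw [if_pos hc, if_pos hc, map_smul, map_add, map_smul, map_smul, map_add, map_mul, hn, hn]
  · rw [if_neg hc, if_neg hc, smul_zero, map_zero]

end Atoms

/-! ### §3. The three-band interaction in general-pair form -/

section Emery

/-- The cosets of the fourteen Emery atoms (hopping roots; site classes). [cite: PavariniEtAl2001, eq. (1)] -/
def emeryAtomCoset : Fin 14 → Site 2 :=
  ![cuSite, oxSite, cuSite, oySite, oxSite, oxSite, oxSite, oxSite, cuSite, oxSite, oySite, cuSite, oxSite, oySite]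

/-- The bond vectors of the eight hopping atoms (`0` for the six on-site atoms). [cite: PavariniEtAl2001, eq. (1)] -/
def emeryAtomVec : Fin 14 → Site 2 :=
  ![unitVec 0, unitVec 0, unitVec 1, unitVec 1, ppVec 0, ppVec 1, ppVec 2, ppVec 3, 0, 0, 0, 0, 0, 0]

/-- The site-energy amplitude of each atom (`1` for atoms `8,9,10`). [cite: PavariniEtAl2001, eq. (1)] -/
def emeryAtomEps : Fin 14 → ℝ := ![0, 0, 0, 0, 0, 0, 0, 0, 1, 1, 1, 0, 0, 0]

/-- The repulsion amplitude of each atom (`1` for atoms `11,12,13`). [cite: PavariniEtAl2001, eq. (1)] -/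
def emeryAtomU : Fin 14 → ℝ := ![0, 0, 0, 0, 0, 0, 0, 0, 0, 0, 0, 1, 1, 1]

/-- **The Emery atoms by index**: the first eight are the sublattice hopping atoms `(coset, vector)`, the last six the on-site atoms
`(coset, ε, U)`. [cite: PavariniEtAl2001, eq. (1)] -/
theorem emeryAtoms_eq (a : Fin 14) :
    emeryAtoms a = if a.1 < 8 then sublatticeVectorHopping liebPeriods (emeryAtomCoset a) (emeryAtomVec a) 1
      else sublatticeOnSite liebPeriods (emeryAtomCoset a) (emeryAtomEps a) (emeryAtomU a) := by
  fin_cases a <;> rfl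

/-- The hopping atoms have nonzero bond vectors. [cite: PavariniEtAl2001, eq. (1)] -/
theorem emeryAtomVec_ne_zero {a : Fin 14} (ha : a.1 < 8) : emeryAtomVec a ≠ 0 := by
  fin_cases a
  · exact uvec_ne_zero 0
  · exact uvec_ne_zero 0
  · exact uvec_ne_zero 1
  · exact uvec_ne_zero 1
  · exact ppVec_ne_zero 0
  · exact ppVec_ne_zero 1
  · exact ppVec_ne_zero 2
  · exact ppVec_ne_zero 3
  all_goals exact absurd ha (by decide)

/-- The indicator of the ORIENTED bond class `(c, v)` between two lattice points, symmetrised: `[y = x + v ∧ x ∈ c] + [x = y + v ∧ y ∈ c]`.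
[cite: ValentiStolzeHirschfeld1991, §II] -/
def hopInd (q : Fin 2 → ℕ) (c v x y : Site 2) : ℝ :=
  (if y = x + v ∧ InCoset q c x then 1 else 0) + (if x = y + v ∧ InCoset q c y then 1 else 0)

variable (w : Finset (Site 2) → ℝ) (θ : Fin 14 → ℝ) (Λ : Finset (Site 2))

/-- The pair coefficient of atom `a` between two sites of the window: `w{p̄,p̄'}·hopInd_a(p̄,p̄')` (zero for on-site atoms).
[cite: ValentiStolzeHirschfeld1991, §II] -/
def emeryAtomPairCoef (a : Fin 14) (p p' : PolySite Λ) : ℝ :=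
  w {ofLex p.1, ofLex p'.1} * (if a.1 < 8 then hopInd liebPeriods (emeryAtomCoset a) (emeryAtomVec a) (ofLex p.1) (ofLex p'.1) else 0)

/-- The repulsion coefficient of atom `a` at a site: `w{p̄}·U_a·[p̄ ∈ c_a]`. [cite: ValentiStolzeHirschfeld1991, §II] -/
def emeryAtomUCoef (a : Fin 14) (p : PolySite Λ) : ℝ :=
  w {ofLex p.1} * (emeryAtomU a * (if InCoset liebPeriods (emeryAtomCoset a) (ofLex p.1) then 1 else 0))

/-- The site-energy coefficient of atom `a` at a site: `w{p̄}·ε_a·[p̄ ∈ c_a]`. [cite: ValentiStolzeHirschfeld1991, §II] -/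
def emeryAtomECoef (a : Fin 14) (p : PolySite Λ) : ℝ :=
  w {ofLex p.1} * (emeryAtomEps a * (if InCoset liebPeriods (emeryAtomCoset a) (ofLex p.1) then 1 else 0))

/-- **The pair weights `τ` of the reweighted three-band cluster**: `τ(p,p') = Σ_a θ_a · w{p̄,p̄'} · hopInd_a(p̄, p̄')`.
[cite: ValentiStolzeHirschfeld1991, §II] -/
def emeryTau (p p' : PolySite Λ) : ℝ := ∑ a : Fin 14, θ a * emeryAtomPairCoef w Λ a p p'

/-- **The repulsions `υ` of the reweighted three-band cluster**: `υ(p) = Σ_a θ_a · w{p̄} · U_a [p̄ ∈ c_a]` (= `w{p̄}·θ₁₁` on Cu, `w{p̄}·θ₁₂` on O_x,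
`w{p̄}·θ₁₃` on O_y). [cite: ValentiStolzeHirschfeld1991, §II] -/
def emeryUps (p : PolySite Λ) : ℝ := ∑ a : Fin 14, θ a * emeryAtomUCoef w Λ a p

/-- **The site energies `ν` of the reweighted three-band cluster**: `ν(p) = Σ_a θ_a · w{p̄} · ε_a [p̄ ∈ c_a]` (= `w{p̄}·θ₈` on Cu, `w{p̄}·θ₉` on O_x,
`w{p̄}·θ₁₀` on O_y). [cite: ValentiStolzeHirschfeld1991, §II] -/
def emeryNu (p : PolySite Λ) : ℝ := ∑ a : Fin 14, θ a * emeryAtomECoef w Λ a p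

/-- The canonical identification `PolySite Λ ≃ {x // x ∈ Λ}`. [folklore] -/
private def polyAttachEquiv : PolySite Λ ≃ {x // x ∈ Λ} :=
  ⟨fun a => ⟨ofLex a.1, PolySite.ofLex_mem a⟩, fun x => PolySite.pt x.1 x.2, fun a => PolySite.pt_ofLex a, fun _ => Subtype.ext rfl⟩

/-- Sums over `Λ.attach` are sums over `PolySite Λ`. [folklore] -/
private theorem sum_attach_eq_sum_polySite {M : Type*} [AddCommMonoid M] (g : {x // x ∈ Λ} → M) :
    ∑ x ∈ Λ.attach, g x = ∑ p : PolySite Λ, g ⟨ofLex p.1, PolySite.ofLex_mem p⟩ := by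
  rw [← Finset.univ_eq_attach]
  exact (Fintype.sum_equiv (polyAttachEquiv Λ) _ _ fun _ => rfl).symm

/-- A double sum over `PolySite Λ` whose inner index is pinned to `p̄ + v`. [folklore] -/
private theorem sum_ite_eq_add_vec {M : Type*} [AddCommMonoid M] (v : Site 2) (P : PolySite Λ → Prop) [DecidablePred P]
    (G : PolySite Λ → PolySite Λ → M) (p : PolySite Λ) :
    ∑ p' : PolySite Λ, (if ofLex p'.1 = ofLex p.1 + v ∧ P p then G p p' else 0) =
      if h : ofLex p.1 + v ∈ Λ ∧ P p then G p (PolySite.pt (ofLex p.1 + v) h.1) else 0 := by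
  classical
  by_cases h : ofLex p.1 + v ∈ Λ ∧ P p
  · rw [dif_pos h, Finset.sum_eq_single (PolySite.pt (ofLex p.1 + v) h.1)]
    · rw [if_pos ⟨rfl, h.2⟩]
    · intro p' _ hp'
      rw [if_neg]
      rintro ⟨h1, -⟩
      exact hp' (Subtype.ext (congrArg toLex h1))
    · exact fun h' => absurd (Finset.mem_univ _) h'
  · rw [dif_neg h]
    refine Finset.sum_eq_zero fun p' _ => if_neg ?_
    rintro ⟨h1, h2⟩
    exact h ⟨h1 ▸ PolySite.ofLex_mem p', h2⟩

/-- The scalar `((r · (A + B)) : ℂ) • T` with two real indicators splits into two `ite`s. [folklore] -/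
private theorem smul_ind_add_ind {T : FermionOp Λ} (r : ℝ) (A B : Prop) [Decidable A] [Decidable B] :
    ((r * ((if A then (1 : ℝ) else 0) + (if B then 1 else 0)) : ℝ) : ℂ) • T =
      (if A then ((r : ℝ) : ℂ) • T else 0) + (if B then ((r : ℝ) : ℂ) • T else 0) := by
  by_cases hA : A <;> by_cases hB : B <;>
    simp only [hA, hB, if_true, if_false, add_zero, zero_add, mul_one, mul_zero, Complex.ofReal_zero, zero_smul]
  rw [show ((r * (1 + 1) : ℝ) : ℂ) = (r : ℂ) + (r : ℂ) by push_cast; ring, add_smul]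


/-- **The per-atom general-pair form** of the Emery atom `a` on `Λ` with weight `w`:
`−Σ_{p≠p',σ} w{p̄,p̄'}·hopInd_a(p̄,p̄')·c†_{pσ}c_{p'σ} + Σ_p w{p̄}·U_a[p̄ ∈ c_a]·n_{p↑}n_{p↓} + Σ_p w{p̄}·ε_a[p̄ ∈ c_a]·(n_{p↑}+n_{p↓})`.
[cite: ValentiStolzeHirschfeld1991, §II] -/
def emeryAtomGP (a : Fin 14) : FermionOp Λ :=
  generalPairHamiltonian (emeryAtomPairCoef w Λ a) (emeryAtomUCoef w Λ a) (emeryAtomECoef w Λ a)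

/-- **The reweighted local Hamiltonian of each Emery atom is its per-atom general-pair form.** [cite: ValentiStolzeHirschfeld1991, §II]
[cite: PavariniEtAl2001, eq. (1)] -/
theorem localHamiltonian_reweight_emeryAtoms (a : Fin 14) :
    (⟨fun X => (w X : ℂ) • (emeryAtoms a).Φ X⟩ : FermionInteraction 2).localHamiltonian Λ = emeryAtomGP w Λ a := by
  classical
  rw [emeryAtoms_eq, emeryAtomGP, generalPairHamiltonian]
  simp only [emeryAtomPairCoef, emeryAtomUCoef, emeryAtomECoef]
  by_cases ha : a.1 < 8
  · -- hopping atom: the on-site sums vanish (`U_a = ε_a = 0`)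
    have hU : emeryAtomU a = 0 := by fin_cases a <;> first | rfl | exact absurd ha (by decide)
    have hE : emeryAtomEps a = 0 := by fin_cases a <;> first | rfl | exact absurd ha (by decide)
    simp only [if_pos ha, hU, hE, zero_mul, mul_zero, Complex.ofReal_zero, zero_smul, Finset.sum_const_zero, add_zero]
    set c := emeryAtomCoset a
    set v := emeryAtomVec a
    have hv : v ≠ 0 := emeryAtomVec_ne_zero ha
    rw [localHamiltonian_reweight_sublatticeVectorHopping w liebPeriods c hv 1 Λ, sum_attach_eq_sum_polySite]
    -- pull the `σ`-sum inside an indicator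
    have hσ : ∀ (C : Prop) [Decidable C] (F : Fin 2 → FermionOp Λ),
        (∑ σ : Fin 2, (if C then F σ else (0 : FermionOp Λ))) = if C then ∑ σ : Fin 2, F σ else 0 := by
      intro C _ F
      split_ifs <;> simp
    -- first oriented family: `p' = p + v`
    have hA : ∑ p : PolySite Λ, ∑ p' : PolySite Λ,
        (if ofLex p'.1 = ofLex p.1 + v ∧ InCoset liebPeriods c (ofLex p.1) then
          ∑ σ : Fin 2, ((w {ofLex p.1, ofLex p'.1} : ℝ) : ℂ) • (creation (orb p σ) * annihilation (orb p' σ)) else (0 : FermionOp Λ)) =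
        ∑ p : PolySite Λ, if h : ofLex p.1 + v ∈ Λ ∧ InCoset liebPeriods c (ofLex p.1) then
          ((w {ofLex p.1, ofLex p.1 + v} : ℝ) : ℂ) • ∑ σ : Fin 2, (cAt (ofLex p.1) (PolySite.ofLex_mem p) σ)ᴴ * cAt (ofLex p.1 + v) h.1 σ else 0 := by
      refine Finset.sum_congr rfl fun p _ => ?_
      rw [sum_ite_eq_add_vec Λ v (fun p => InCoset liebPeriods c (ofLex p.1))
        (fun p p' => ∑ σ : Fin 2, ((w {ofLex p.1, ofLex p'.1} : ℝ) : ℂ) • (creation (orb p σ) * annihilation (orb p' σ))) p]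
      by_cases h : ofLex p.1 + v ∈ Λ ∧ InCoset liebPeriods c (ofLex p.1)
      · rw [dif_pos h, dif_pos h, Finset.smul_sum]
        refine Finset.sum_congr rfl fun σ _ => ?_
        rw [PolySite.ofLex_coe_pt, cAt, cAt, annihilation_conjTranspose, PolySite.pt_ofLex]
      · rw [dif_neg h, dif_neg h]
    -- second oriented family: `p = p' + v` (swap the summation order)
    have hB : ∑ p : PolySite Λ, ∑ p' : PolySite Λ,
        (if ofLex p.1 = ofLex p'.1 + v ∧ InCoset liebPeriods c (ofLex p'.1) then
          ∑ σ : Fin 2, ((w {ofLex p.1, ofLex p'.1} : ℝ) : ℂ) • (creation (orb p σ) * annihilation (orb p' σ)) else (0 : FermionOp Λ)) =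
        ∑ p' : PolySite Λ, if h : ofLex p'.1 + v ∈ Λ ∧ InCoset liebPeriods c (ofLex p'.1) then
          ((w {ofLex p'.1, ofLex p'.1 + v} : ℝ) : ℂ) • ∑ σ : Fin 2, (cAt (ofLex p'.1 + v) h.1 σ)ᴴ * cAt (ofLex p'.1) (PolySite.ofLex_mem p') σ else 0 := by
      rw [Finset.sum_comm]
      refine Finset.sum_congr rfl fun p' _ => ?_
      rw [sum_ite_eq_add_vec Λ v (fun p' => InCoset liebPeriods c (ofLex p'.1))
        (fun p' p => ∑ σ : Fin 2, ((w {ofLex p.1, ofLex p'.1} : ℝ) : ℂ) • (creation (orb p σ) * annihilation (orb p' σ))) p']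
      by_cases h : ofLex p'.1 + v ∈ Λ ∧ InCoset liebPeriods c (ofLex p'.1)
      · rw [dif_pos h, dif_pos h, Finset.smul_sum]
        refine Finset.sum_congr rfl fun σ _ => ?_
        rw [PolySite.ofLex_coe_pt, Finset.pair_comm, cAt, cAt, annihilation_conjTranspose, PolySite.pt_ofLex]
      · rw [dif_neg h, dif_neg h]
    -- assemble: the general-pair triple sum (native `if p ≠ p'`) is matched through unification, never restated
    symm
    rw [neg_eq_iff_eq_neg]
    calc _ = ∑ p : PolySite Λ, ∑ p' : PolySite Λ, ∑ σ : Fin 2,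
            ((if ofLex p'.1 = ofLex p.1 + v ∧ InCoset liebPeriods c (ofLex p.1) then
                ((w {ofLex p.1, ofLex p'.1} : ℝ) : ℂ) • (creation (orb p σ) * annihilation (orb p' σ)) else (0 : FermionOp Λ)) +
              (if ofLex p.1 = ofLex p'.1 + v ∧ InCoset liebPeriods c (ofLex p'.1) then
                ((w {ofLex p.1, ofLex p'.1} : ℝ) : ℂ) • (creation (orb p σ) * annihilation (orb p' σ)) else (0 : FermionOp Λ))) := by
          refine Finset.sum_congr rfl fun p _ => Finset.sum_congr rfl fun p' _ => Finset.sum_congr rfl fun σ _ => ?_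
          by_cases hpp : p ≠ p'
          · rw [if_pos hpp, hopInd, smul_ind_add_ind]
          · have hpp' : p = p' := not_ne_iff.1 hpp
            subst hpp'
            have h1 : ¬ (ofLex p.1 = ofLex p.1 + v ∧ InCoset liebPeriods c (ofLex p.1)) := fun h => hv (left_eq_add.1 h.1)
            rw [if_neg hpp, if_neg h1, add_zero]
      _ = -(∑ p : PolySite Λ, if h : ofLex p.1 + v ∈ Λ ∧ InCoset liebPeriods c (ofLex p.1) then
            ((w {ofLex p.1, ofLex p.1 + v} : ℝ) : ℂ) • (-((1 : ℝ) : ℂ) • ∑ σ : Fin 2,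
              ((cAt (ofLex p.1) (PolySite.ofLex_mem p) σ)ᴴ * cAt (ofLex p.1 + v) h.1 σ +
                (cAt (ofLex p.1 + v) h.1 σ)ᴴ * cAt (ofLex p.1) (PolySite.ofLex_mem p) σ)) else 0) := by
          simp only [Finset.sum_add_distrib, hσ]
          rw [hA, hB, ← Finset.sum_add_distrib, ← Finset.sum_neg_distrib]
          refine Finset.sum_congr rfl fun p _ => ?_
          by_cases h : ofLex p.1 + v ∈ Λ ∧ InCoset liebPeriods c (ofLex p.1)
          · rw [dif_pos h, dif_pos h, dif_pos h, ← smul_add, ← Finset.sum_add_distrib, Complex.ofReal_one, neg_one_smul, smul_neg, neg_neg]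
          · rw [dif_neg h, dif_neg h, dif_neg h, add_zero, neg_zero]
  · -- on-site atom: the pair sum vanishes
    simp only [if_neg ha, mul_zero, Complex.ofReal_zero, zero_smul, ite_self, Finset.sum_const_zero, neg_zero, zero_add]
    rw [localHamiltonian_reweight_sublatticeOnSite w liebPeriods (emeryAtomCoset a) (emeryAtomEps a) (emeryAtomU a) Λ, sum_attach_eq_sum_polySite,
      ← Finset.sum_add_distrib]
    refine Finset.sum_congr rfl fun p _ => ?_
    by_cases hc : InCoset liebPeriods (emeryAtomCoset a) (ofLex p.1)
    · rw [if_pos hc]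
      simp only [if_pos hc, mul_one, nAt, PolySite.pt_ofLex]
      push_cast
      rw [smul_add, smul_smul, smul_smul, mul_comm ((w _ : ℝ) : ℂ) ((emeryAtomEps a : ℝ) : ℂ), mul_comm ((w _ : ℝ) : ℂ) ((emeryAtomU a : ℝ) : ℂ),
        add_comm]
    · rw [if_neg hc]
      simp only [if_neg hc, mul_zero, Complex.ofReal_zero, zero_smul, add_zero]

/-- **The general-pair operator with the Emery coefficients is the `θ`-combination of the per-atom forms** (pure bookkeeping of sums).
[cite: ValentiStolzeHirschfeld1991, §II] -/
theorem generalPairHamiltonian_emery_eq_sum :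
    generalPairHamiltonian (emeryTau w θ Λ) (emeryUps w θ Λ) (emeryNu w θ Λ) = ∑ a : Fin 14, ((θ a : ℝ) : ℂ) • emeryAtomGP w Λ a :=
  generalPairHamiltonian_linear θ (fun a => emeryAtomPairCoef w Λ a) (fun a => emeryAtomUCoef w Λ a) (fun a => emeryAtomECoef w Λ a)

/-- The reweighted three-band interaction is the linear family of the reweighted atoms (zero base). [cite: PavariniEtAl2001, eq. (1)] -/
private theorem reweight_emeryInteraction_eq_linearFamily :
    (⟨fun X => (w X : ℂ) • (emeryInteraction θ).Φ X⟩ : FermionInteraction 2) =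
      FermionInteraction.linearFamily ⟨fun X => (w X : ℂ) • (hubbardFermionInteraction 2 0 0).Φ X⟩
        (fun a => (⟨fun X => (w X : ℂ) • (emeryAtoms a).Φ X⟩ : FermionInteraction 2)) θ := by
  show FermionInteraction.mk _ = FermionInteraction.mk _
  congr 1
  funext X
  simp only [emeryInteraction, FermionInteraction.linearFamily_apply, smul_add, Finset.smul_sum, smul_comm ((w X : ℝ) : ℂ) ((θ _ : ℝ) : ℂ)]

/-- The reweighted zero base has zero local Hamiltonian. [cite: PavariniEtAl2001, eq. (1)] -/
private theorem localHamiltonian_reweight_base_zero :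
    (⟨fun X => (w X : ℂ) • (hubbardFermionInteraction 2 0 0).Φ X⟩ : FermionInteraction 2).localHamiltonian Λ = 0 := by
  rw [FermionInteraction.localHamiltonian_eq_sum]
  refine Finset.sum_eq_zero fun X _ => ?_
  dsimp only
  rw [hubbardFermionInteraction_zero_zero_apply, smul_zero]
  split_ifs <;> simp

/-- **THE THREE-BAND INTERACTION IN GENERAL-PAIR FORM**: for every window `Λ`, weight `w` and coupling vector `θ`,
`H^w_Λ[emeryInteraction θ] = generalPairHamiltonian (emeryTau w θ Λ) (emeryUps w θ Λ) (emeryNu w θ Λ)`.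
[cite: ValentiStolzeHirschfeld1991, §II] [cite: PavariniEtAl2001, eq. (1)] -/
theorem localHamiltonian_reweight_emeryInteraction_eq_generalPair :
    (⟨fun X => (w X : ℂ) • (emeryInteraction θ).Φ X⟩ : FermionInteraction 2).localHamiltonian Λ =
      generalPairHamiltonian (emeryTau w θ Λ) (emeryUps w θ Λ) (emeryNu w θ Λ) := by
  rw [reweight_emeryInteraction_eq_linearFamily, FermionInteraction.localHamiltonian_linearFamily, localHamiltonian_reweight_base_zero, zero_add,
    generalPairHamiltonian_emery_eq_sum]
  exact Finset.sum_congr rfl fun a _ => by rw [localHamiltonian_reweight_emeryAtoms]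

end Emery


end Literature.MathematicalPhysics.QuantumLattice

end
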